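import Literature.Barriers.Parity.SiegelZeroDichotomyPairHLEq57
import HarnessLib

/-!
# Tao–Teräväinen 2022, Proposition 5.2 for `k = 2`, `ℓ = 0` — proved

Topic `Literature/Barriers/Parity`. This file DISCHARGES the named fact
`Literature.Barriers.Parity.TaoTeravainen2021_prop52_pair` of `SiegelZeroDichotomyPairHLSiegelModel.lean`
(Tao–Teräväinen arXiv:2109.06291, Proposition 5.2 (asymptotics for the Selberg sieve approximant)
for the pair pattern `Λν(n+h₁)Λν(n+h₂)`), from the tree's glue
`TaoTeravainen2021_prop52_pair_of_stepTwo` ("Multiplying these estimates together … it suffices to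
establish the bounds (5.7), (5.8), (5.9)") and the four proved inputs: Lemma 5.1
(`TaoTeravainen2021_lemma51_pair_holds`), (5.7) (`TaoTeravainen2021_eq57_pair_holds`), (5.8)
(`TaoTeravainen2021_eq58_pair_holds`) and (5.9) (`TaoTeravainen2021_eq59_pair_holds`).
[cite: TaoTeravainen2021, Proposition 5.2 and its proof (§5)]
-/

namespace Literature.Barriers.Parity

/-- **Tao–Teräväinen 2022, Proposition 5.2 for the pair pattern — PROVED** (`TaoTeravainen2021_prop52_pair`):
"`∑_{n ≤ x} Λν(n+h₁)Λν(n+h₂) = ∑_{n ≤ x} Λ_{Siegel,h₁}(n)Λ_{Siegel,h₂}(n) + O(x/log^{1/20} η)`" in the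
normalised form of the fact, from Lemma 5.1, (5.7), (5.8), (5.9) via the tree's glue.
[cite: TaoTeravainen2021, Proposition 5.2 and its proof (§5)] -/
theorem TaoTeravainen2021_prop52_pair_holds : TaoTeravainen2021_prop52_pair :=
  TaoTeravainen2021_prop52_pair_of_stepTwo TaoTeravainen2021_lemma51_pair_holds
    TaoTeravainen2021_eq57_pair_holds TaoTeravainen2021_eq58_pair_holds TaoTeravainen2021_eq59_pair_holds

end Literature.Barriers.Parity
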